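import Mathlib
import HarnessLib
import Summits.ResolutionOfSingularities.ResolutionOfSingularities.Theorems.WildQuotientsWildQuotientResolutionJordanFiveVertexPowers
import Summits.ResolutionOfSingularities.ResolutionOfSingularities.Theorems.WildQuotientsWildQuotientResolutionJordanFiveLociW1

/-!
# RUNG V5 (`J₅`), Hcov step 2 (first half): `V[x_b⁴] ⊆ V[x_a³] ∪ chartW₁`
(crux stmt-ResolutionOfSingularities-15640 `WildQuotients.WildQuotientResolution`, line `Sketch`;
chain w45c RUNG V5 `JordanFive.jordanFive_hasResolution_of_bricks`, brick **`Hcov`** (res-L1-w45c-plan-1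
RULING 10:50Z), = res-L1-w45c-idea-2's W₂ DESIGN LINE §5 (A)(B) by-product
(`L/res-L1-w45c-idea-2/W2-DESIGN.md` 400ebbeeb3422d46); written by res-D-pv-033 AS res-L1-w45c-stub-5.
[OURS · L1 W4.5c] — Rees-algebra bookkeeping over p523816 (`gens12`/`chart`), p526168 (`chartW₁`,
`tSqHT2`) and the uniform power certificate (`…JordanFiveVertexPowers`); NOT a statement of any
manuscript.)

* `reesT_hPrime_sq_eq` — `H′²t = g₁t + g₃₉t + 4·g₅t − 2·g₃₅t − 4·g₈t + 4·g₃₄t` in `k[x][I₁₂t]`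
  (res-L1-w45c-stub-1's certificate for `H′² ∈ I₁₂`, read in degree one);
* **`chart_one_le_chart_zero_sup_chartW₁` — `chart 1 ≤ chart 0 ⊔ chartW₁`**: at a point `v` off
  `V[x_a³]`, every `x_a`-divisible section `g_j t` lies in `𝔭_v` (uniform power certificate), so
  `H′²t ≡ x_b⁴t` and `T′²H′t² ≡ (x_b⁴t)·(x_b⁴t + …)` modulo `𝔭_v`; off `chartW₁ = D₊(H′²t·T′²H′t²)` one
  of the two sections lies in the prime `𝔭_v`, hence `x_b⁴t ∈ 𝔭_v`, i.e. `v ∉ V[x_b⁴]`.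
With the vertex cover (p527406) this leaves only `chart 2 ⊆ chart 0 ∪ W₁ ∪ W₂ ∪ chart 3` for `Hcov`
(after the W₂ term).
-/

-- single-problem summit: the doubled namespace component `ResolutionOfSingularities` is forced
set_option linter.dupNamespace false

noncomputable section

open CategoryTheory AlgebraicGeometry TopologicalSpace MvPolynomial Polynomial
open Literature.AlgebraicGeometry.Resolution

namespace Summit.ResolutionOfSingularities.ResolutionOfSingularities.Theorems.WildQuotientResolution.JordanFive

variable (k : Type) [Field k] (n : ℕ) (a b c d : Fin n)

/-- **`H′²t = g₁t + g₃₉t + 4·g₅t − 2·g₃₅t − 4·g₈t + 4·g₃₄t`** (res-L1-w45c-stub-1's certificate for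
`H′² ∈ I₁₂`, p526168, in degree one). [OURS · L1 W4.5c] [folklore] -/
theorem reesT_hPrime_sq_eq :
    reesT (JordanFour.hPrime k n a b c ^ 2) (hPrime_sq_mem_I12 k n a b c d) =
      reesT (gens12 k n a b c d 1) (gens12_mem_I12 k n a b c d 1) +
        reesT (gens12 k n a b c d 39) (gens12_mem_I12 k n a b c d 39) +
        (4 : MvPolynomial (Fin n) k) • reesT (gens12 k n a b c d 5) (gens12_mem_I12 k n a b c d 5) +
        (-2 : MvPolynomial (Fin n) k) • reesT (gens12 k n a b c d 35) (gens12_mem_I12 k n a b c d 35) +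
        (-4 : MvPolynomial (Fin n) k) • reesT (gens12 k n a b c d 8) (gens12_mem_I12 k n a b c d 8) +
        (4 : MvPolynomial (Fin n) k) • reesT (gens12 k n a b c d 34) (gens12_mem_I12 k n a b c d 34) := by
  apply Subtype.ext
  simp only [Subalgebra.coe_add, Subalgebra.coe_smul, coe_reesT, Polynomial.smul_monomial,
    smul_eq_mul, ← map_add]
  congr 1
  simp only [gens12, Matrix.cons_val, JordanFour.hPrime]
  ring

/-- **Off `V[x_a³]` and off `chartW₁`, `x_b⁴t` lies in the homogeneous prime** (idea-2 W2-DESIGN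
§5 (A)(B)): every `x_a`-divisible section `g_j t` lies in `𝔭_v` (uniform power certificate), so
`H′²t ≡ x_b⁴t` and `T′²H′t² ≡ (x_b⁴t)·(x_b⁴t + …)` modulo `𝔭_v`, and one of the two sections of
`chartW₁ = D₊(H′²t·T′²H′t²)` lies in the prime `𝔭_v`. [OURS · L1 W4.5c] [folklore] -/
theorem reesT_one_mem_of_not_mem_chart_zero_chartW₁ (v : affineBlowup (I12 k n a b c d))
    (hv0 : v ∉ chart k n a b c d 0) (hvW : v ∉ chartW₁ k n a b c d) :
    reesT (gens12 k n a b c d 1) (gens12_mem_I12 k n a b c d 1) ∈ v.asHomogeneousIdeal.toIdeal := by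
  by_contra k1
  have h𝔭 : v.asHomogeneousIdeal.toIdeal.IsPrime := v.isPrime
  -- the sections in `𝔭_v`
  have k0 := reesT_gens12_mem_of_not_mem_chart k n a b c d 0 v hv0
  have kA : ∀ j : Fin 40, (exps12 j).1 ≠ 0 →
      reesT (gens12 k n a b c d j) (gens12_mem_I12 k n a b c d j) ∈ v.asHomogeneousIdeal.toIdeal :=
    fun j hj => reesT_gens12_mem_of_reesT_zero_mem k n a b c d _ h𝔭 k0 j hj
  -- `v ∉ chartW₁`: the product section lies in `𝔭_v`
  have hprod : reesT (JordanFour.hPrime k n a b c ^ 2) (hPrime_sq_mem_I12 k n a b c d) *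
      tSqHT2 k n a b c d ∈ v.asHomogeneousIdeal.toIdeal := by
    by_contra h
    exact hvW ((chartW₁_def k n a b c d).symm ▸ (Proj.mem_basicOpen _ _ _).mpr h)
  -- `H′²t − g₁t ∈ 𝔭_v`
  have hH : reesT (JordanFour.hPrime k n a b c ^ 2) (hPrime_sq_mem_I12 k n a b c d) -
      reesT (gens12 k n a b c d 1) (gens12_mem_I12 k n a b c d 1) ∈ v.asHomogeneousIdeal.toIdeal := by
    rw [reesT_hPrime_sq_eq]
    have e : ∀ x y₁ y₂ y₃ y₄ y₅ : reesAlgebra (I12 k n a b c d),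
        x + y₁ + y₂ + y₃ + y₄ + y₅ - x = y₁ + y₂ + y₃ + y₄ + y₅ := by intros; ring
    rw [e]
    refine Ideal.add_mem _ (Ideal.add_mem _ (Ideal.add_mem _ (Ideal.add_mem _
      (kA 39 (by simp [exps12]))
      (Submodule.smul_of_tower_mem _ _ (kA 5 (by simp [exps12]))))
      (Submodule.smul_of_tower_mem _ _ (kA 35 (by simp [exps12]))))
      (Submodule.smul_of_tower_mem _ _ (kA 8 (by simp [exps12]))))
      (Submodule.smul_of_tower_mem _ _ (kA 34 (by simp [exps12])))
  -- the `A`-factor of `T′²H′t² = g₁t·A + g₀t·B` minus `g₁t` lies in `𝔭_v`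
  have hAfac : reesT (gens12 k n a b c d 1) (gens12_mem_I12 k n a b c d 1) +
      (-8 : MvPolynomial (Fin n) k) • reesT (gens12 k n a b c d 8) (gens12_mem_I12 k n a b c d 8) +
      (-1 : MvPolynomial (Fin n) k) • reesT (gens12 k n a b c d 35) (gens12_mem_I12 k n a b c d 35) +
      (21 : MvPolynomial (Fin n) k) • reesT (gens12 k n a b c d 5) (gens12_mem_I12 k n a b c d 5) +
      (6 : MvPolynomial (Fin n) k) • reesT (gens12 k n a b c d 4) (gens12_mem_I12 k n a b c d 4) +
      (6 : MvPolynomial (Fin n) k) • reesT (gens12 k n a b c d 34) (gens12_mem_I12 k n a b c d 34) +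
      (-2 : MvPolynomial (Fin n) k) • reesT (gens12 k n a b c d 39) (gens12_mem_I12 k n a b c d 39) -
      reesT (gens12 k n a b c d 1) (gens12_mem_I12 k n a b c d 1) ∈ v.asHomogeneousIdeal.toIdeal := by
    have e : ∀ x y₁ y₂ y₃ y₄ y₅ y₆ : reesAlgebra (I12 k n a b c d),
        x + y₁ + y₂ + y₃ + y₄ + y₅ + y₆ - x = y₁ + y₂ + y₃ + y₄ + y₅ + y₆ := by intros; ring
    rw [e]
    refine Ideal.add_mem _ (Ideal.add_mem _ (Ideal.add_mem _ (Ideal.add_mem _ (Ideal.add_mem _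
      (Submodule.smul_of_tower_mem _ _ (kA 8 (by simp [exps12])))
      (Submodule.smul_of_tower_mem _ _ (kA 35 (by simp [exps12]))))
      (Submodule.smul_of_tower_mem _ _ (kA 5 (by simp [exps12]))))
      (Submodule.smul_of_tower_mem _ _ (kA 4 (by simp [exps12]))))
      (Submodule.smul_of_tower_mem _ _ (kA 34 (by simp [exps12]))))
      (Submodule.smul_of_tower_mem _ _ (kA 39 (by simp [exps12])))
  rcases h𝔭.mem_or_mem hprod with hH2 | hT
  · -- `H′²t ∈ 𝔭` ⇒ `g₁t ∈ 𝔭`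
    exact k1 (by simpa using Ideal.sub_mem _ hH2 hH)
  · -- `T′²H′t² ∈ 𝔭`: `g₁t·A ∈ 𝔭` with `A ≡ g₁t`
    rw [tSqHT2_eq_reesT_combination] at hT
    have hB : reesT (gens12 k n a b c d 0) (gens12_mem_I12 k n a b c d 0) *
        ((-18 : MvPolynomial (Fin n) k) • reesT (gens12 k n a b c d 20) (gens12_mem_I12 k n a b c d 20) +
          (-30 : MvPolynomial (Fin n) k) • reesT (gens12 k n a b c d 18) (gens12_mem_I12 k n a b c d 18) +
          (-9 : MvPolynomial (Fin n) k) • reesT (gens12 k n a b c d 37) (gens12_mem_I12 k n a b c d 37) +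
          (-6 * X d + 10 * X c + 2 * X b + X a : MvPolynomial (Fin n) k) •
            reesT (gens12 k n a b c d 1) (gens12_mem_I12 k n a b c d 1) +
          (36 : MvPolynomial (Fin n) k) • reesT (gens12 k n a b c d 10) (gens12_mem_I12 k n a b c d 10) +
          (9 : MvPolynomial (Fin n) k) • reesT (gens12 k n a b c d 9) (gens12_mem_I12 k n a b c d 9) +
          (18 * X d - 12 * X c - 6 * X b - 2 * X a : MvPolynomial (Fin n) k) •
            reesT (gens12 k n a b c d 8) (gens12_mem_I12 k n a b c d 8) +
          (-6 * X d - X a : MvPolynomial (Fin n) k) •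
            reesT (gens12 k n a b c d 35) (gens12_mem_I12 k n a b c d 35) +
          (-18 : MvPolynomial (Fin n) k) • reesT (gens12 k n a b c d 6) (gens12_mem_I12 k n a b c d 6) +
          (-9 * X d + 12 * X c + 6 * X b : MvPolynomial (Fin n) k) •
            reesT (gens12 k n a b c d 4) (gens12_mem_I12 k n a b c d 4)) ∈
        v.asHomogeneousIdeal.toIdeal := Ideal.mul_mem_right _ _ k0
    have hgA := (Ideal.add_mem_iff_left _ hB).mp hT
    rcases h𝔭.mem_or_mem hgA with h1 | hA
    · exact k1 h1
    · exact k1 (by simpa using Ideal.sub_mem _ hA hAfac)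


/-- **`V[x_b⁴] ⊆ V[x_a³] ∪ chartW₁`** (idea-2 W2-DESIGN §5, by-product of (A)(B)).
[OURS · L1 W4.5c] [folklore] -/
theorem chart_one_le_chart_zero_sup_chartW₁ :
    chart k n a b c d 1 ≤ chart k n a b c d 0 ⊔ chartW₁ k n a b c d := by
  intro v hv
  rw [Opens.mem_sup]
  by_contra hcon
  rw [not_or] at hcon
  exact (Proj.mem_basicOpen _ _ _).mp ((chart_eq_basicOpen k n a b c d 1) ▸ hv)
    (reesT_one_mem_of_not_mem_chart_zero_chartW₁ k n a b c d v hcon.1 hcon.2)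

end Summit.ResolutionOfSingularities.ResolutionOfSingularities.Theorems.WildQuotientResolution.JordanFive

end
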